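import Literature.LinearAlgebra.Matrix.CubicChevalleyDifferential     -- ★ (D4a) file 1 (this seat): `surjective_differential_iff`, `forall_exists_trace_zero_differential_iff`
import Mathlib.LinearAlgebra.Matrix.NonsingularInverse
import HarnessLib

/-!
# F0 · P3c · line LH6 «StCharTS» — ROAD «HC-D» brick (D4a), file 2: the Chevalley differential of `M₃(E)` DESCENDED to the Lie algebra of the unitary group
# `𝔲 = {X | (X.map σ)ᵀ J + J X = 0}` — parities of `(tr, tr ∘ adj, det)` on `𝔲` and «onto the `F`-form `E⁻ × F × E⁻` ⟺ `X` regular»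

Cell `pub/hodgecm-mathlib`, crux H413 = `stmt-HodgeConjecture-24833` (lane `--supports … --as helper`), route HCCMUnconditional; seat LH1-p03 (g9); brick (D4a) of the
ROAD «HC-D» (in-house pay-down of the named input `hDGliO` «`|D_G|^{−1∕2} ∈ L¹_loc`» of RUNG0 v2, [HarishChandra1970 VII §1 Thm. 15]), dealt BY NAME by the road holder
F0P2-p01 (g23) (bus F0∕P2 2026-09-02T16:05:00Z DEAL #1; target ruled 16:11:14Z).  THEOREMS ONLY (no definition ∕ instance ∕ notation ∕ named fact ∕ `sorry`).

SETTING (generic; the model `U(σ, Φ₃)(K)` is the instance `E := K`, `J := Φ₃`): `E` a field, `σ : E →+* E` an involution (`hσ`; `F = E^σ`, `E⁻ = {a | σ a = −a}`), `J ∈ M₃(E)`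
σ-hermitian (`hJσ : (J.map σ)ᵀ = J`) with `det J` a unit (`hJ`); the LIE ALGEBRA OF THE UNITARY GROUP is the carrier predicate `(X.map σ)ᵀ * J + J * X = 0` of ★ C4u
`F0P3cStCharTSCayleyChartUnitary` (`hιr`, `x = 1`) ∕ ★ `F0P3cStCharTSCayleyChartUnitaryModel.exists_cayley_chart_haar_unitary` (`h𝔲`).  No definition: the σ-semilinear
involution `θ Y := −(J⁻¹ (Y.map σ)ᵀ J)` of `M₃(E)`, whose fixed points are `𝔲`, is spelled inline.

* §1 θ-CALCULUS: `map_transpose_mul`, `map_transpose_map_transpose` (`((Yσᵀ)σ)ᵀ = Y`), `trace_map_transpose` (`tr Yσᵀ = σ tr Y`), `trace_conjInv` (`tr (J⁻¹ A J) = tr A`),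
  `map_transpose_eq_of_mem` (`X ∈ 𝔲 ⇒ Xσᵀ = −J X J⁻¹`), `theta_map_transpose` (`(θY)σᵀ = −J Y J⁻¹`), `theta_theta`, `average_mem` (`⅟2 (Y + θY) ∈ 𝔲`), `trace_theta`
  (`tr θY = −σ tr Y`), `trace_mul_theta` (`X ∈ 𝔲 ⇒ tr (X θY) = σ tr (XY)`), `adjugate_conj_eq` (`adj (J A J⁻¹) = J adj A J⁻¹`), `trace_adjugate_mul_theta`
  (`X ∈ 𝔲 ⇒ tr (adj X · θY) = −σ tr (adj X · Y)`).
* §2 PARITIES on `𝔲` [Rogawski1990 §1.9: `𝔲` is an `F`-form of `𝔤𝔩₃`]: `sigma_trace_of_mem` (`σ tr X = −tr X`), `sigma_trace_adjugate_of_mem` (`σ E₂ X = E₂ X`),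
  `sigma_det_of_mem` (`σ det X = −det X`): the Chevalley map sends `𝔲` into `E⁻ × F × E⁻`.
* §3 DESCENT: **`exists_mem_differential_eq_of_linearIndependent`** — for `X ∈ 𝔲` REGULAR (`1, X, X²` independent over `E`) every `(u, c, d) ∈ E⁻ × F × E⁻` is
  `L_X(Y) = (tr Y, tr X·tr Y − tr (XY), tr (adj X·Y))` for some `Y ∈ 𝔲` (average an `M₃(E)`-preimage of ★ `surjective_differential_iff` against `θ`; `2 ∈ Eˣ`);
  `exists_mem_trace_zero_differential_eq_of_linearIndependent` (the `𝔰𝔲`-slice: `tr Y = 0`, targets `F × E⁻`); and the converse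
  `linearIndependent_of_forall_exists_mem` (onto the `F`-form ⇒ regular; `σ ≠ id`, `E = F ⊕ E⁻`).  Together: **the Chevalley differential of `𝔲′ = 𝔲 ∩ 𝔰𝔩₃` at `X` is onto
  `F × E⁻` iff `X` is regular** — the (i)∕(ii) input of the road's D5 (i) (submersion straightening near a regular `X₀`).

HONEST LABEL: count-neutral helper of the road «HC-D» (which pays ONE named input of the (S-𝔇) organ `stub_EllipticPackage`); closes no organ.  HC_CM is proved only
modulo the 7 printed citations (2 remaining: hLiu418 = `stmt-HodgeConjecture-24832`, h413 = `stmt-HodgeConjecture-24833`) until rung 0 closes.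

## References
* [HornJohnson2013] R. A. Horn, C. R. Johnson, *Matrix Analysis*, 2nd ed. (2013): §0.8.10 (0.8.10.1) (`d det = tr (adj A · dA)`), Thm. 3.3.15 (nonderogatory matrices).
* [Rogawski1990] J. D. Rogawski, *Automorphic Representations of Unitary Groups in Three Variables*, Ann. of Math. Stud. 123 (1990), §1.9 p. 8 (the unitary group and its
  Lie algebra as `F`-forms defined by `σ` and `Φ`).
* [HarishChandra1970] Harish-Chandra, *Harmonic analysis on reductive p-adic groups*, LNM 162 (1970), Part VII §1 Thm. 15 — the statement this road pays (context).
-/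

set_option autoImplicit false
-- the mandated namespace has the single-problem summit's repeated segment (`HodgeConjecture.HodgeConjecture`)
set_option linter.dupNamespace false

open Matrix
open Literature.LinearAlgebra.Matrix.CubicChevalleyDifferential

namespace Summit.HodgeConjecture.HodgeConjecture.Cruxes.H413.F0P3cStCharTSChevalleyDifferential

variable {E : Type*} [Field E] (σ : E →+* E) (hσ : ∀ x, σ (σ x) = x)
  {J : Matrix (Fin 3) (Fin 3) E} (hJσ : (J.map σ)ᵀ = J) (hJ : IsUnit J.det)

/-! ## §1 The σ-semilinear involution `θ Y = −J⁻¹ (Y.map σ)ᵀ J` -/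

/-- `((A B).map σ)ᵀ = (B.map σ)ᵀ (A.map σ)ᵀ`. [cite: HornJohnson2013, §0.2.5 (transpose of a product)] -/
theorem map_transpose_mul (A B : Matrix (Fin 3) (Fin 3) E) : ((A * B).map σ)ᵀ = (B.map σ)ᵀ * (A.map σ)ᵀ := by
  rw [Matrix.map_mul, transpose_mul]

include hσ in
/-- `σ` is an involution: `(((Y.map σ)ᵀ).map σ)ᵀ = Y`. [cite: Rogawski1990, §1.9 p. 8] -/
theorem map_transpose_map_transpose (Y : Matrix (Fin 3) (Fin 3) E) : (((Y.map σ)ᵀ).map σ)ᵀ = Y := by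
  rw [transpose_map, transpose_transpose, Matrix.map_map]
  have h : (σ : E → E) ∘ σ = id := funext hσ
  rw [h, Matrix.map_id]

/-- `tr (Y.map σ)ᵀ = σ (tr Y)`. [cite: HornJohnson2013, §0.2.5] -/
theorem trace_map_transpose (Y : Matrix (Fin 3) (Fin 3) E) : trace (Y.map σ)ᵀ = σ (trace Y) := by
  rw [trace_transpose, AddMonoidHom.map_trace]

include hJ in
/-- `tr (J⁻¹ A J) = tr A` (`det J` a unit). [cite: HornJohnson2013, §0.8.10 (0.8.10.1)] -/
theorem trace_conjInv (A : Matrix (Fin 3) (Fin 3) E) : trace (J⁻¹ * A * J) = trace A := by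
  rw [trace_mul_cycle, mul_nonsing_inv _ hJ, one_mul]

include hJ in
/-- `tr (J A J⁻¹) = tr A` (`det J` a unit). [cite: HornJohnson2013, §0.8.10 (0.8.10.1)] -/
theorem trace_conj (A : Matrix (Fin 3) (Fin 3) E) : trace (J * A * J⁻¹) = trace A := by
  rw [trace_mul_cycle, nonsing_inv_mul _ hJ, one_mul]

include hJ in
/-- For `X ∈ 𝔲`: `(X.map σ)ᵀ = −J X J⁻¹`. [cite: Rogawski1990, §1.9 p. 8] -/
theorem map_transpose_eq_of_mem {X : Matrix (Fin 3) (Fin 3) E} (hX : (X.map σ)ᵀ * J + J * X = 0) : (X.map σ)ᵀ = -(J * X * J⁻¹) := by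
  have h : (X.map σ)ᵀ * J = -(J * X) := eq_neg_of_add_eq_zero_left hX
  calc (X.map σ)ᵀ = (X.map σ)ᵀ * J * J⁻¹ := (mul_nonsing_inv_cancel_right _ _ hJ).symm
    _ = -(J * X * J⁻¹) := by rw [h, neg_mul]

include hσ hJσ hJ in
/-- `(θY σ)ᵀ = −J Y J⁻¹` for `θ Y = −J⁻¹ (Y.map σ)ᵀ J` (apply `σ`-transpose to `J θY = −(Y.map σ)ᵀ J`; `(J.map σ)ᵀ = J`, `σ² = id`). [cite: Rogawski1990, §1.9 p. 8] -/
theorem theta_map_transpose (Y : Matrix (Fin 3) (Fin 3) E) : ((-(J⁻¹ * (Y.map σ)ᵀ * J)).map σ)ᵀ = -(J * Y * J⁻¹) := by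
  have hJW : J * -(J⁻¹ * (Y.map σ)ᵀ * J) = -((Y.map σ)ᵀ * J) := by
    rw [mul_neg, ← mul_assoc, ← mul_assoc, mul_nonsing_inv _ hJ, one_mul]
  have hL : ((J * -(J⁻¹ * (Y.map σ)ᵀ * J)).map σ)ᵀ = ((-(J⁻¹ * (Y.map σ)ᵀ * J)).map σ)ᵀ * J := by
    rw [map_transpose_mul σ J, hJσ]
  have hR : ((-((Y.map σ)ᵀ * J)).map σ)ᵀ = -(J * Y) := by
    rw [Matrix.map_neg _ (map_neg σ), transpose_neg, map_transpose_mul, hJσ, map_transpose_map_transpose σ hσ]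
  have h1 : ((-(J⁻¹ * (Y.map σ)ᵀ * J)).map σ)ᵀ * J = -(J * Y) := by rw [← hL, hJW, hR]
  -- `h1 : (θY σ)ᵀ * J = -(J * Y)`
  calc ((-(J⁻¹ * (Y.map σ)ᵀ * J)).map σ)ᵀ = ((-(J⁻¹ * (Y.map σ)ᵀ * J)).map σ)ᵀ * J * J⁻¹ := (mul_nonsing_inv_cancel_right _ _ hJ).symm
    _ = -(J * Y * J⁻¹) := by rw [h1, neg_mul]

include hσ hJσ hJ in
/-- `θ (θ Y) = Y`. [cite: Rogawski1990, §1.9 p. 8] -/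
theorem theta_theta (Y : Matrix (Fin 3) (Fin 3) E) : -(J⁻¹ * ((-(J⁻¹ * (Y.map σ)ᵀ * J)).map σ)ᵀ * J) = Y := by
  rw [theta_map_transpose σ hσ hJσ hJ, mul_neg, neg_mul, neg_neg, ← mul_assoc, ← mul_assoc, nonsing_inv_mul _ hJ, one_mul, nonsing_inv_mul_cancel_right _ _ hJ]

include hσ hJσ hJ in
/-- **The θ-average lies in `𝔲`**: `Z := ⅟2 • (Y + θY)` satisfies `(Z.map σ)ᵀ J + J Z = 0`. [cite: Rogawski1990, §1.9 p. 8] -/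
theorem average_mem [Invertible (2 : E)] (Y : Matrix (Fin 3) (Fin 3) E) :
    (((2 : E)⁻¹ • (Y + -(J⁻¹ * (Y.map σ)ᵀ * J))).map σ)ᵀ * J + J * ((2 : E)⁻¹ • (Y + -(J⁻¹ * (Y.map σ)ᵀ * J))) = 0 := by
  have hθ := theta_map_transpose σ hσ hJσ hJ Y
  have hσ2 : σ (2 : E)⁻¹ = (2 : E)⁻¹ := by rw [map_inv₀, map_ofNat]
  have hA : (((2 : E)⁻¹ • (Y + -(J⁻¹ * (Y.map σ)ᵀ * J))).map σ)ᵀ = (2 : E)⁻¹ • ((Y.map σ)ᵀ + -(J * Y * J⁻¹)) := by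
    rw [Matrix.map_smul _ _ (fun a => by rw [smul_eq_mul, smul_eq_mul, map_mul, hσ2]), transpose_smul, Matrix.map_add _ (map_add σ), transpose_add, hθ]
  have hB : ((Y.map σ)ᵀ + -(J * Y * J⁻¹)) * J = (Y.map σ)ᵀ * J - J * Y := by
    rw [add_mul, neg_mul, nonsing_inv_mul_cancel_right _ _ hJ, ← sub_eq_add_neg]
  have hC : J * (Y + -(J⁻¹ * (Y.map σ)ᵀ * J)) = J * Y - (Y.map σ)ᵀ * J := by
    rw [mul_add, mul_neg, ← mul_assoc, ← mul_assoc, mul_nonsing_inv _ hJ, one_mul, ← sub_eq_add_neg]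
  rw [hA, smul_mul_assoc, mul_smul_comm, ← smul_add, hB, hC, sub_add_sub_cancel, sub_self, smul_zero]

include hJ in
/-- `tr θY = −σ (tr Y)`. [cite: HornJohnson2013, §0.8.10 (0.8.10.1)] -/
theorem trace_theta (Y : Matrix (Fin 3) (Fin 3) E) : trace (-(J⁻¹ * (Y.map σ)ᵀ * J)) = -σ (trace Y) := by
  rw [trace_neg, trace_conjInv hJ, trace_map_transpose]

include hJ in
/-- For `X ∈ 𝔲`: `tr (X · θY) = σ tr (X Y)`. [cite: Rogawski1990, §1.9 p. 8] -/
theorem trace_mul_theta {X : Matrix (Fin 3) (Fin 3) E} (hX : (X.map σ)ᵀ * J + J * X = 0) (Y : Matrix (Fin 3) (Fin 3) E) :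
    trace (X * -(J⁻¹ * (Y.map σ)ᵀ * J)) = σ (trace (X * Y)) := by
  have hXσ := map_transpose_eq_of_mem σ hJ hX
  rw [mul_neg, trace_neg, ← mul_assoc, ← mul_assoc, trace_mul_cycle, ← mul_assoc]
  -- `⊢ -tr (J X J⁻¹ Yσᵀ) = σ tr (X Y)`
  rw [show J * X * J⁻¹ = -(X.map σ)ᵀ by rw [hXσ, neg_neg], neg_mul, trace_neg, neg_neg, ← map_transpose_mul, trace_map_transpose, trace_mul_comm]

include hJ in
/-- `adj (J A J⁻¹) = J (adj A) J⁻¹` (`det J` a unit; `adj J = det J • J⁻¹`, `adj J⁻¹ = (det J)⁻¹ • J`). [cite: HornJohnson2013, §0.8.2] -/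
theorem adjugate_conj_eq (A : Matrix (Fin 3) (Fin 3) E) : adjugate (J * A * J⁻¹) = J * adjugate A * J⁻¹ := by
  have hadjJ : adjugate J = J.det • J⁻¹ := by
    have h := mul_adjugate J
    calc adjugate J = J⁻¹ * (J * adjugate J) := by rw [← mul_assoc, nonsing_inv_mul _ hJ, one_mul]
      _ = J.det • J⁻¹ := by rw [h, mul_smul_comm, mul_one]
  have hadjJinv : adjugate J⁻¹ = J⁻¹.det • J := by
    have h := mul_adjugate J⁻¹
    calc adjugate J⁻¹ = J * (J⁻¹ * adjugate J⁻¹) := by rw [← mul_assoc, mul_nonsing_inv _ hJ, one_mul]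
      _ = J⁻¹.det • J := by rw [h, mul_smul_comm, mul_one]
  rw [adjugate_mul_distrib, adjugate_mul_distrib, hadjJ, hadjJinv, smul_mul_assoc, mul_smul_comm, mul_smul_comm, smul_smul, det_nonsing_inv,
    Ring.inverse_mul_cancel _ hJ, one_smul, mul_assoc]

include hJ in
/-- For `X ∈ 𝔲`: `tr (adj X · θY) = −σ tr (adj X · Y)`. [cite: Rogawski1990, §1.9 p. 8] [cite: HornJohnson2013, §0.8.10 (0.8.10.1)] -/
theorem trace_adjugate_mul_theta {X : Matrix (Fin 3) (Fin 3) E} (hX : (X.map σ)ᵀ * J + J * X = 0) (Y : Matrix (Fin 3) (Fin 3) E) :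
    trace (adjugate X * -(J⁻¹ * (Y.map σ)ᵀ * J)) = -σ (trace (adjugate X * Y)) := by
  have hXσ := map_transpose_eq_of_mem σ hJ hX
  rw [mul_neg, trace_neg, ← mul_assoc, ← mul_assoc, trace_mul_cycle, ← mul_assoc, ← adjugate_conj_eq hJ]
  -- `⊢ -tr (adj (J X J⁻¹) Yσᵀ) = -σ tr (adj X · Y)`
  have hadj : adjugate (J * X * J⁻¹) = ((adjugate X).map σ)ᵀ := by
    rw [show J * X * J⁻¹ = -(X.map σ)ᵀ by rw [hXσ, neg_neg], ← neg_one_smul E, adjugate_smul, Fintype.card_fin]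
    norm_num
    rw [← adjugate_transpose, ← RingHom.mapMatrix_apply, ← RingHom.map_adjugate, RingHom.mapMatrix_apply]
  rw [hadj, ← map_transpose_mul, trace_map_transpose, trace_mul_comm]

/-! ## §2 Parities of the Chevalley map on `𝔲` -/

include hJ in
/-- `X ∈ 𝔲 ⇒ σ (tr X) = −tr X` (`tr X ∈ E⁻`). [cite: Rogawski1990, §1.9 p. 8] -/
theorem sigma_trace_of_mem {X : Matrix (Fin 3) (Fin 3) E} (hX : (X.map σ)ᵀ * J + J * X = 0) : σ (trace X) = -trace X := by
  rw [← trace_map_transpose, map_transpose_eq_of_mem σ hJ hX, trace_neg, trace_conj hJ]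

include hJ in
/-- `X ∈ 𝔲 ⇒ σ (tr adj X) = tr adj X` (`E₂(X) ∈ F`). [cite: Rogawski1990, §1.9 p. 8] -/
theorem sigma_trace_adjugate_of_mem {X : Matrix (Fin 3) (Fin 3) E} (hX : (X.map σ)ᵀ * J + J * X = 0) :
    σ (trace (adjugate X)) = trace (adjugate X) := by
  have hXσ := map_transpose_eq_of_mem σ hJ hX
  have h1 : trace (adjugate (X.map σ)ᵀ) = σ (trace (adjugate X)) := by
    rw [← adjugate_transpose, ← RingHom.mapMatrix_apply, ← RingHom.map_adjugate, RingHom.mapMatrix_apply, trace_map_transpose]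
  rw [← h1, hXσ, ← neg_one_smul E, adjugate_smul, Fintype.card_fin]
  norm_num
  rw [adjugate_conj_eq hJ, trace_conj hJ]

include hJ in
/-- `X ∈ 𝔲 ⇒ σ (det X) = −det X` (`det X ∈ E⁻`). [cite: Rogawski1990, §1.9 p. 8] -/
theorem sigma_det_of_mem {X : Matrix (Fin 3) (Fin 3) E} (hX : (X.map σ)ᵀ * J + J * X = 0) : σ (det X) = -det X := by
  have hXσ := map_transpose_eq_of_mem σ hJ hX
  have h1 : det (X.map σ)ᵀ = σ (det X) := by rw [det_transpose, ← RingHom.mapMatrix_apply, ← RingHom.map_det]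
  rw [← h1, hXσ, det_neg, det_conj ((isUnit_iff_isUnit_det J).2 hJ), Fintype.card_fin]
  norm_num

/-! ## §3 Descent: the differential on `𝔲` is onto `E⁻ × F × E⁻` iff `X` is regular -/

include hσ hJσ hJ in
/-- **DESCENT OF KOSTANT'S CRITERION (⇒)**: for `X ∈ 𝔲` with `1, X, X²` independent, every `(u, c, d) ∈ E⁻ × F × E⁻` is `L_X(Y)` for some `Y ∈ 𝔲` — the θ-average
`⅟2 (Y₀ + θY₀)` of an `M₃(E)`-preimage `Y₀` (★ `surjective_differential_iff`). [cite: HornJohnson2013, Thm. 3.3.15] [cite: Rogawski1990, §1.9 p. 8] -/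
theorem exists_mem_differential_eq_of_linearIndependent [Invertible (2 : E)] {X : Matrix (Fin 3) (Fin 3) E}
    (hX : (X.map σ)ᵀ * J + J * X = 0) (hreg : LinearIndependent E ![(1 : Matrix (Fin 3) (Fin 3) E), X, X ^ 2])
    (u c d : E) (hu : σ u = -u) (hc : σ c = c) (hd : σ d = -d) :
    ∃ Y : Matrix (Fin 3) (Fin 3) E, (Y.map σ)ᵀ * J + J * Y = 0 ∧
      trace Y = u ∧ trace X * trace Y - trace (X * Y) = c ∧ trace (adjugate X * Y) = d := by
  obtain ⟨Y₀, hY₀⟩ := (surjective_differential_iff X).2 hreg (u, c, d)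
  simp only [Prod.mk.injEq] at hY₀
  obtain ⟨h₀, h₁, h₂⟩ := hY₀
  have h2 : (2 : E) ≠ 0 := Invertible.ne_zero 2
  -- the θ-average `Y := 2⁻¹ • W`, `W := Y₀ + θY₀`
  set W : Matrix (Fin 3) (Fin 3) E := Y₀ + -(J⁻¹ * (Y₀.map σ)ᵀ * J) with hW
  have hWtr : trace W = 2 * u := by
    rw [hW, trace_add, trace_theta σ hJ, h₀, hu, neg_neg, two_mul]
  have hWmid : trace X * trace W - trace (X * W) = 2 * c := by
    have hσc : σ (trace X * trace Y₀ - trace (X * Y₀)) = c := by rw [h₁, hc]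
    rw [map_sub, map_mul, sigma_trace_of_mem σ hJ hX] at hσc
    rw [hW, mul_add, trace_add, trace_add, mul_add, trace_theta σ hJ, trace_mul_theta σ hJ hX]
    linear_combination h₁ + hσc
  have hWadj : trace (adjugate X * W) = 2 * d := by
    rw [hW, mul_add, trace_add, trace_adjugate_mul_theta σ hJ hX, h₂, hd, neg_neg, two_mul]
  refine ⟨(2 : E)⁻¹ • W, average_mem σ hσ hJσ hJ Y₀, ?_, ?_, ?_⟩
  · rw [trace_smul, hWtr, smul_eq_mul, inv_mul_cancel_left₀ h2]
  · rw [mul_smul_comm (2 : E)⁻¹ X W, trace_smul, trace_smul, smul_eq_mul, smul_eq_mul, mul_left_comm, ← mul_sub, hWmid, inv_mul_cancel_left₀ h2]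
  · rw [mul_smul_comm, trace_smul, hWadj, smul_eq_mul, inv_mul_cancel_left₀ h2]

include hσ hJσ hJ in
/-- **Trace-zero slice of the descent** (`𝔰𝔲`-directions, targets `(c, d) ∈ F × E⁻`). [cite: HornJohnson2013, Thm. 3.3.15] [cite: Rogawski1990, §1.9 p. 8] -/
theorem exists_mem_trace_zero_differential_eq_of_linearIndependent [Invertible (2 : E)] {X : Matrix (Fin 3) (Fin 3) E}
    (hX : (X.map σ)ᵀ * J + J * X = 0) (hreg : LinearIndependent E ![(1 : Matrix (Fin 3) (Fin 3) E), X, X ^ 2])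
    (c d : E) (hc : σ c = c) (hd : σ d = -d) :
    ∃ Y : Matrix (Fin 3) (Fin 3) E, (Y.map σ)ᵀ * J + J * Y = 0 ∧
      trace Y = 0 ∧ trace X * trace Y - trace (X * Y) = c ∧ trace (adjugate X * Y) = d :=
  exists_mem_differential_eq_of_linearIndependent σ hσ hJσ hJ hX hreg 0 c d (by rw [map_zero, neg_zero]) hc hd

include hσ in
/-- **(⇐) onto the `F`-form ⇒ regular**: if every `(c, d) ∈ F × E⁻` is hit by a trace-zero `Y ∈ 𝔲`, then `1, X, X²` are independent.  With `δ := ε − σ ε ≠ 0` (`σ ≠ id`)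
one has `E = F ⊕ F·δ`, `σ δ = −δ`; a general target `(c, d)` splits as `(c⁺, d⁻) + δ·(c⁻∕δ, d⁺∕δ)` with both summands in `F × E⁻`, and `L_X` is `E`-linear, so ★
`forall_exists_trace_zero_differential_iff` applies. [cite: HornJohnson2013, Thm. 3.3.15] [cite: Rogawski1990, §1.9 p. 8] -/
theorem linearIndependent_of_forall_exists_mem [Invertible (2 : E)] (hσ1 : σ ≠ RingHom.id E) {X : Matrix (Fin 3) (Fin 3) E}
    (h : ∀ c d : E, σ c = c → σ d = -d → ∃ Y : Matrix (Fin 3) (Fin 3) E, (Y.map σ)ᵀ * J + J * Y = 0 ∧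
      trace Y = 0 ∧ trace X * trace Y - trace (X * Y) = c ∧ trace (adjugate X * Y) = d) :
    LinearIndependent E ![(1 : Matrix (Fin 3) (Fin 3) E), X, X ^ 2] := by
  -- an anti-invariant unit `δ`
  have hne : ¬ ∀ x, σ x = x := fun hall => hσ1 (RingHom.ext hall)
  obtain ⟨ε, hε⟩ := not_forall.1 hne
  set δ : E := ε - σ ε with hδ
  have hδ0 : δ ≠ 0 := fun h0 => hε (sub_eq_zero.1 h0).symm
  have hσδ : σ δ = -δ := by rw [hδ, map_sub, hσ, neg_sub]
  have h2 : (2 : E) ≠ 0 := Invertible.ne_zero 2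
  have hσ2 : σ (2 : E)⁻¹ = (2 : E)⁻¹ := by rw [map_inv₀, map_ofNat]
  rw [← forall_exists_trace_zero_differential_iff]
  intro c d
  -- the `F × E⁻` parts of `(c, d)` and of `δ⁻¹ • (c, d)`
  have hc1 : σ ((2 : E)⁻¹ * (c + σ c)) = (2 : E)⁻¹ * (c + σ c) := by rw [map_mul, hσ2, map_add, hσ, add_comm]
  have hd1 : σ ((2 : E)⁻¹ * (d - σ d)) = -((2 : E)⁻¹ * (d - σ d)) := by rw [map_mul, hσ2, map_sub, hσ, ← mul_neg, neg_sub]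
  have hc2 : σ ((2 : E)⁻¹ * (c - σ c) / δ) = (2 : E)⁻¹ * (c - σ c) / δ := by
    rw [map_div₀, map_mul, hσ2, map_sub, hσ, hσδ, ← neg_sub, mul_neg, neg_div_neg_eq]
  have hd2 : σ ((2 : E)⁻¹ * (d + σ d) / δ) = -((2 : E)⁻¹ * (d + σ d) / δ) := by
    rw [map_div₀, map_mul, hσ2, map_add, hσ, hσδ, add_comm, div_neg]
  obtain ⟨Y₁, -, hY₁0, hY₁c, hY₁d⟩ := h _ _ hc1 hd1
  obtain ⟨Y₂, -, hY₂0, hY₂c, hY₂d⟩ := h _ _ hc2 hd2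
  refine ⟨Y₁ + δ • Y₂, ?_, ?_, ?_⟩
  · rw [trace_add, trace_smul, hY₁0, hY₂0, smul_zero, add_zero]
  · have e1 : trace X * trace (Y₁ + δ • Y₂) - trace (X * (Y₁ + δ • Y₂)) =
        (trace X * trace Y₁ - trace (X * Y₁)) + δ * (trace X * trace Y₂ - trace (X * Y₂)) := by
      rw [mul_add X, trace_add, trace_add, trace_smul, mul_smul_comm δ X, trace_smul, smul_eq_mul, smul_eq_mul]; ring
    rw [e1, hY₁c, hY₂c, mul_div_cancel₀ _ hδ0, ← mul_add]
    rw [show c + σ c + (c - σ c) = 2 * c by ring, inv_mul_cancel_left₀ h2]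
  · rw [mul_add, trace_add, mul_smul_comm, trace_smul, hY₁d, hY₂d, smul_eq_mul, mul_div_cancel₀ _ hδ0, ← mul_add]
    rw [show d - σ d + (d + σ d) = 2 * d by ring, inv_mul_cancel_left₀ h2]

end Summit.HodgeConjecture.HodgeConjecture.Cruxes.H413.F0P3cStCharTSChevalleyDifferential
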